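import Literature.AlgebraicGeometry.ProjectiveSpace.CayleyBacharachPointSets
import Literature.AlgebraicGeometry.ProjectiveSpace.IndependentConditionsUnlessCollinear
import Literature.AlgebraicGeometry.ProjectiveSpace.PointsHilbertFunctionWorkedExamples
import HarnessLib

/-!
# Cayley–Bacharach for all but two or three points of a complete intersection
# (Eisenbud–Green–Harris, *Cayley–Bacharach theorems and conjectures*, after Theorem CB5)

Topic `Literature/AlgebraicGeometry/ProjectiveSpace`, namespace
`Literature.AlgebraicGeometry.ProjectiveSpace`. Lane `lit-hodgefound`, seat `lit-hodgefound-p32`,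
row gen26-#10. Theorems only (no definition, no named fact); two printed consequences of Bacharach's
Theorem CB5, read off the tree's `CayleyBacharachPointSets.finrank_idealDegree_sub_eq_card_sub_hilbert`.

## The source, as printed

D. Eisenbud, M. Green, J. Harris, Bull. AMS 33 (1996), § 1.2, after Theorem CB5 (p. 304): "Theorem CB5
(Bacharach). Let `X_1, X_2 ⊂ ℙ²` be plane curves of degrees `d` and `e` respectively, intersecting in
`d · e` points `Γ = X_1 ∩ X_2 = {p_1, …, p_{de}}`, and suppose that `Γ` is the disjoint union of subsets
`Γ'` and `Γ''`. Set `s = d + e − 3`. If `k ≤ s` is a nonnegative integer, then the dimension of the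
vector space of forms of degree `k` vanishing on `Γ'` (modulo those containing all of `Γ`) is equal to
the failure of `Γ''` to impose independent conditions on forms of degree `s − k`. … Note that Theorem
CB4 is just the case where `k = s` and `Γ''` is a single point … **Theorem CB5 says further that any
curve of degree `s − 1 = d + e − 4` containing all but two points of `Γ` contains `Γ` and there exists a
curve of degree `s − 1` containing all but three points `p, q, r ∈ Γ` but not containing `Γ` if and only
if `p`, `q`, and `r` are collinear, and so on.**"

## Dictionary

As in `ProjectiveSpace/CayleyBacharachPointSets` (whose Theorem CB5 is stated for a reduced complete
intersection `Γ` of `r` hypersurfaces `f_m = 0` of degrees `d_m > 0` in `ℙ^r`, `[f_0, …, f_{r−1}]` a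
weakly regular sequence, `#Γ = ∏ d_m`, so that `s = Σ d_m − r − 1`): the points are non-zero, pairwise
non-proportional coordinate vectors `p : ι → k^{r+1}`; `I(Z) = projVanishingIdeal Z`; "`p, q, r`
collinear" = the three coordinate vectors lie in a `2`-dimensional subspace `span{u, v}`. The degree
`s − 1` is written `s'` with `s' + r + 2 = Σ d_m` (plane curves: `s' + 4 = d + e`). `k` is infinite.

## What is here (all `theorem`s)

* § 1 the two-point and three-point Hilbert functions in degree one (`hilbert_one_pair`,
  `hilbert_one_triple_of_not_collinear`, `hilbert_one_triple_of_collinear`: two distinct points impose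
  two conditions on linear forms; three impose three unless collinear, then two).
* § 2 in `ℙ^r`: **`idealDegree_projVanishingIdeal_compl_pair_eq`** ("any hypersurface of degree `s − 1`
  containing all but two points of `Γ` contains `Γ`"), `idealDegree_projVanishingIdeal_compl_triple_eq`
  (the same for three non-collinear points), `finrank_idealDegree_projVanishingIdeal_compl_triple`
  (three collinear points: exactly one more dimension), and
  **`exists_form_compl_triple_iff_collinear`** ("there exists a [hypersurface] of degree `s − 1`
  containing all but three points `p, q, r ∈ Γ` but not containing `Γ` iff `p, q, r` are collinear").
* § 3 the plane-curve statements as printed (`r = 2`, `s − 1 = d + e − 4`):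
  `idealDegree_projVanishingIdeal_compl_pair_eq_of_planeCurves`,
  `exists_form_compl_triple_iff_collinear_of_planeCurves`.

## References

* [EisenbudGreenHarris1996] D. Eisenbud, M. Green, J. Harris, *Cayley–Bacharach theorems and
  conjectures*, Bull. Amer. Math. Soc. 33 (1996) 295–324, § 1.2, Theorem CB5 and the remarks following
  it (p. 304).
-/

noncomputable section

open MvPolynomial Module RingTheory.Sequence
open Literature.RingTheory.MvPolynomial

universe u

namespace Literature.AlgebraicGeometry.ProjectiveSpace

variable {k : Type u} [Field k] {σ : Type*} [Fintype σ] {ι : Type*} [Fintype ι]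

/-! ### § 1 Two and three points in degree one -/

/-- **Two distinct points impose independent conditions on linear forms**: `h_{{p, q}}(1) = 2`.
[cite: EisenbudGreenHarris1996, §1.2, after Thm. CB5 (p. 304)] -/
theorem hilbert_one_pair {p q : σ → k} (hp : p ≠ 0) (hq : q ≠ 0)
    (hpq : p ∉ (k ∙ q : Submodule k (σ → k))) :
    finrank k (homogeneousSubmodule σ k 1) -
      finrank k (idealDegree (projVanishingIdeal (Set.range ![p, q])) 1) = 2 := by
  have hqp : q ∉ (k ∙ p : Submodule k (σ → k)) := by
    intro h
    obtain ⟨c, hc⟩ := Submodule.mem_span_singleton.mp h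
    have hc0 : c ≠ 0 := by
      rintro rfl
      exact hq (by rw [← hc, zero_smul])
    exact hpq (Submodule.mem_span_singleton.mpr ⟨c⁻¹, by rw [← hc, smul_smul, inv_mul_cancel₀ hc0, one_smul]⟩)
  have h := hilbert_projVanishingIdeal_eq_card ![p, q] (fun m => by fin_cases m <;> assumption)
    (fun a b hab => by
      fin_cases a <;> fin_cases b
      · exact absurd rfl hab
      · exact hpq
      · exact hqp
      · exact absurd rfl hab) (n := 1) (by simp)
  simpa using h

/-- **Three points not on a line impose independent conditions on linear forms**: `h_{{p, q, r}}(1) = 3`.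
[cite: EisenbudGreenHarris1996, §1.2, after Thm. CB5 (p. 304)] -/
theorem hilbert_one_triple_of_not_collinear (q : Fin 3 → σ → k) (h0 : ∀ i, q i ≠ 0)
    (hq : Pairwise fun i j => q i ∉ (k ∙ q j : Submodule k (σ → k)))
    (hcol : ¬ ∃ u v : σ → k, ∀ i, q i ∈ Submodule.span k {u, v}) :
    finrank k (homogeneousSubmodule σ k 1) -
      finrank k (idealDegree (projVanishingIdeal (Set.range q)) 1) = 3 := by
  classical
  have h := hilbert_projVanishingIdeal_eq_card_of_collinear_card_le q h0 hq (n := 1) (by simp)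
    (fun s ⟨u, v, huv⟩ => by
      by_contra hs
      have hs3 : s = Finset.univ := Finset.eq_univ_of_card s (by
        have h3 := Finset.card_le_univ s
        simp only [Fintype.card_fin] at h3 ⊢
        omega)
      exact hcol ⟨u, v, fun i => huv i (hs3 ▸ Finset.mem_univ i)⟩)
  simpa using h

/-- **Three collinear points impose only two conditions on linear forms**: `h_{{p, q, r}}(1) = 2`
(`k` infinite). [cite: EisenbudGreenHarris1996, §1.2, after Thm. CB5 (p. 304)] -/
theorem hilbert_one_triple_of_collinear [Infinite k] (q : Fin 3 → σ → k) (h0 : ∀ i, q i ≠ 0)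
    (hq : Pairwise fun i j => q i ∉ (k ∙ q j : Submodule k (σ → k))) {u v : σ → k}
    (huv : ∀ i, q i ∈ Submodule.span k {u, v}) :
    finrank k (homogeneousSubmodule σ k 1) -
      finrank k (idealDegree (projVanishingIdeal (Set.range q)) 1) = 2 := by
  have h := hilbert_projVanishingIdeal_eq_min_of_mem_span_pair q h0 hq u v huv 1
  simpa using h

/-! ### § 2 All but two or three points of a complete intersection in `ℙ^r` -/

section CompleteIntersection

variable {r : ℕ} [Infinite k] [DecidableEq ι]

/-- The range of the pair `(p i, p j)` is the image of `{i, j}`. [folklore] -/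
private theorem image_pair_eq_range {β α : Type*} (p : β → α) (i j : β) :
    p '' ({i, j} : Set β) = Set.range ![p i, p j] := by
  rw [Set.image_pair, Matrix.range_cons, Matrix.range_cons, Matrix.range_empty, Set.union_empty,
    Set.singleton_union]

/-- The range of the triple `(p i, p j, p l)` is the image of `{i, j, l}`. [folklore] -/
private theorem image_triple_eq_range {β α : Type*} (p : β → α) (i j l : β) :
    p '' ({i, j, l} : Set β) = Set.range ![p i, p j, p l] := by
  rw [Set.image_insert_eq, Set.image_pair, Matrix.range_cons, Matrix.range_cons, Matrix.range_cons,
    Matrix.range_empty, Set.union_empty, Set.singleton_union, Set.singleton_union]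

omit [Fintype ι] [Infinite k] [DecidableEq ι] in
/-- The triple `(p i, p j, p l)` of distinct points of `Γ` consists of non-zero, pairwise
non-proportional vectors. [folklore] -/
private theorem pairwise_triple (p : ι → Fin (r + 1) → k)
    (hp : Pairwise fun i j => p i ∉ (k ∙ p j : Submodule k (Fin (r + 1) → k))) {i j l : ι}
    (hij : i ≠ j) (hil : i ≠ l) (hjl : j ≠ l) :
    Pairwise fun a b => ![p i, p j, p l] a ∉ (k ∙ ![p i, p j, p l] b : Submodule k (Fin (r + 1) → k)) := by
  intro a b hab
  fin_cases a <;> fin_cases b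
  · exact absurd rfl hab
  · exact hp hij
  · exact hp hil
  · exact hp hij.symm
  · exact absurd rfl hab
  · exact hp hjl
  · exact hp hil.symm
  · exact hp hjl.symm
  · exact absurd rfl hab

/-- **CB5, `k = s − 1`: "the dimension of the vector space of forms of degree `s − 1` vanishing on
`Γ' = Γ ∖ Γ''` modulo those containing all of `Γ` is equal to the failure of `Γ''` to impose independent
conditions on forms of degree `1`"** — the tree's Theorem CB5 at `a = 1`, with the monotonicity
`I(Γ)_{s−1} ⊆ I(Γ')_{s−1}` made explicit: `dim I(Γ')_{s−1} = dim I(Γ)_{s−1} + (#Γ'' − h_{Γ''}(1))`.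
[cite: EisenbudGreenHarris1996, §1.2, Thm. CB5 (p. 304)] -/
theorem finrank_idealDegree_projVanishingIdeal_image_eq_add (hr : 1 ≤ r)
    (f : Fin r → MvPolynomial (Fin (r + 1)) k) (d : Fin r → ℕ) (hf : ∀ m, (f m).IsHomogeneous (d m))
    (hd : ∀ m, 0 < d m) (hreg : IsWeaklyRegular (MvPolynomial (Fin (r + 1)) k) (List.ofFn f))
    (p : ι → Fin (r + 1) → k) (h0 : ∀ i, p i ≠ 0)
    (hp : Pairwise fun i j => p i ∉ (k ∙ p j : Submodule k (Fin (r + 1) → k)))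
    (hZ : ∀ i m, eval (p i) (f m) = 0) (hcard : Fintype.card ι = ∏ m, d m) (T : Finset ι)
    {s' : ℕ} (hs' : s' + r + 2 = ∑ m, d m) :
    finrank k (idealDegree (projVanishingIdeal (p '' (T : Set ι))) s') =
      finrank k (idealDegree (projVanishingIdeal (Set.range p)) s') +
        (Tᶜ.card - (finrank k (homogeneousSubmodule (Fin (r + 1)) k 1) -
          finrank k (idealDegree (projVanishingIdeal (p '' ((T : Set ι)ᶜ))) 1))) := by
  have key := finrank_idealDegree_sub_eq_card_sub_hilbert hr f d hf hd hreg p h0 hp hZ hcard T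
    (kk := s') (a := 1) (by omega)
  haveI := finite_homogeneousSubmodule (K := k) (σ := Fin (r + 1)) s'
  haveI : FiniteDimensional k (idealDegree (projVanishingIdeal (p '' (T : Set ι))) s') :=
    Submodule.finiteDimensional_of_le (idealDegree_le_homogeneousSubmodule _ _)
  have hle := Submodule.finrank_mono
    (idealDegree_mono (projVanishingIdeal_anti (Set.image_subset_range p (T : Set ι))) s')
  omega

/-- **"Any curve of degree `s − 1 = d + e − 4` containing all but two points of `Γ` contains `Γ`"** —
for a reduced complete intersection `Γ` of `r` hypersurfaces of degrees `d_m` in `ℙ^r`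
(`s − 1 = Σ d_m − r − 2`): the forms of degree `s − 1` vanishing on `Γ ∖ {p_i, p_j}` are exactly those
vanishing on `Γ` (two distinct points impose independent conditions on linear forms; `k` infinite).
[cite: EisenbudGreenHarris1996, §1.2, after Thm. CB5 (p. 304)] -/
theorem idealDegree_projVanishingIdeal_compl_pair_eq (hr : 1 ≤ r)
    (f : Fin r → MvPolynomial (Fin (r + 1)) k) (d : Fin r → ℕ) (hf : ∀ m, (f m).IsHomogeneous (d m))
    (hd : ∀ m, 0 < d m) (hreg : IsWeaklyRegular (MvPolynomial (Fin (r + 1)) k) (List.ofFn f))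
    (p : ι → Fin (r + 1) → k) (h0 : ∀ i, p i ≠ 0)
    (hp : Pairwise fun i j => p i ∉ (k ∙ p j : Submodule k (Fin (r + 1) → k)))
    (hZ : ∀ i m, eval (p i) (f m) = 0) (hcard : Fintype.card ι = ∏ m, d m) {i j : ι} (hij : i ≠ j)
    {s' : ℕ} (hs' : s' + r + 2 = ∑ m, d m) :
    idealDegree (projVanishingIdeal (p '' ({i, j} : Set ι)ᶜ)) s' =
      idealDegree (projVanishingIdeal (Set.range p)) s' := by
  set T : Finset ι := ({i, j} : Finset ι)ᶜ with hT
  have hTset : (T : Set ι) = ({i, j} : Set ι)ᶜ := by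
    rw [hT, Finset.coe_compl, Finset.coe_insert, Finset.coe_singleton]
  have key := finrank_idealDegree_projVanishingIdeal_image_eq_add hr f d hf hd hreg p h0 hp hZ hcard T hs'
  rw [show Tᶜ = {i, j} from by rw [hT, compl_compl], Finset.card_pair hij, hTset, compl_compl,
    image_pair_eq_range, hilbert_one_pair (h0 i) (h0 j) (hp hij), Nat.sub_self, add_zero] at key
  haveI := finite_homogeneousSubmodule (K := k) (σ := Fin (r + 1)) s'
  haveI : FiniteDimensional k (idealDegree (projVanishingIdeal (p '' ({i, j} : Set ι)ᶜ)) s') :=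
    Submodule.finiteDimensional_of_le (idealDegree_le_homogeneousSubmodule _ _)
  exact (Submodule.eq_of_le_of_finrank_eq
    (idealDegree_mono (projVanishingIdeal_anti (Set.image_subset_range p _)) s') key.symm).symm

/-- **All but three NON-collinear points**: the forms of degree `s − 1` vanishing on `Γ ∖ {p_i, p_j, p_l}`
are exactly those vanishing on `Γ` when `p_i, p_j, p_l` are not collinear (`k` infinite).
[cite: EisenbudGreenHarris1996, §1.2, after Thm. CB5 (p. 304)] -/
theorem idealDegree_projVanishingIdeal_compl_triple_eq (hr : 1 ≤ r)
    (f : Fin r → MvPolynomial (Fin (r + 1)) k) (d : Fin r → ℕ) (hf : ∀ m, (f m).IsHomogeneous (d m))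
    (hd : ∀ m, 0 < d m) (hreg : IsWeaklyRegular (MvPolynomial (Fin (r + 1)) k) (List.ofFn f))
    (p : ι → Fin (r + 1) → k) (h0 : ∀ i, p i ≠ 0)
    (hp : Pairwise fun i j => p i ∉ (k ∙ p j : Submodule k (Fin (r + 1) → k)))
    (hZ : ∀ i m, eval (p i) (f m) = 0) (hcard : Fintype.card ι = ∏ m, d m) {i j l : ι} (hij : i ≠ j)
    (hil : i ≠ l) (hjl : j ≠ l)
    (hcol : ¬ ∃ u v : Fin (r + 1) → k, p i ∈ Submodule.span k {u, v} ∧ p j ∈ Submodule.span k {u, v} ∧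
      p l ∈ Submodule.span k {u, v})
    {s' : ℕ} (hs' : s' + r + 2 = ∑ m, d m) :
    idealDegree (projVanishingIdeal (p '' ({i, j, l} : Set ι)ᶜ)) s' =
      idealDegree (projVanishingIdeal (Set.range p)) s' := by
  set T : Finset ι := ({i, j, l} : Finset ι)ᶜ with hT
  have hTset : (T : Set ι) = ({i, j, l} : Set ι)ᶜ := by
    rw [hT, Finset.coe_compl, Finset.coe_insert, Finset.coe_insert, Finset.coe_singleton]
  have hcard3 : ({i, j, l} : Finset ι).card = 3 := by
    rw [Finset.card_insert_of_notMem (by simp [hij, hil]), Finset.card_pair hjl]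
  have hcol' : ¬ ∃ u v : Fin (r + 1) → k, ∀ a, ![p i, p j, p l] a ∈ Submodule.span k {u, v} := by
    rintro ⟨u, v, huv⟩
    exact hcol ⟨u, v, huv 0, huv 1, huv 2⟩
  have key := finrank_idealDegree_projVanishingIdeal_image_eq_add hr f d hf hd hreg p h0 hp hZ hcard T hs'
  rw [show Tᶜ = {i, j, l} from by rw [hT, compl_compl], hcard3, hTset, compl_compl,
    image_triple_eq_range, hilbert_one_triple_of_not_collinear ![p i, p j, p l]
      (fun a => by fin_cases a <;> exact h0 _) (pairwise_triple p hp hij hil hjl) hcol',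
    Nat.sub_self, add_zero] at key
  haveI := finite_homogeneousSubmodule (K := k) (σ := Fin (r + 1)) s'
  haveI : FiniteDimensional k (idealDegree (projVanishingIdeal (p '' ({i, j, l} : Set ι)ᶜ)) s') :=
    Submodule.finiteDimensional_of_le (idealDegree_le_homogeneousSubmodule _ _)
  exact (Submodule.eq_of_le_of_finrank_eq
    (idealDegree_mono (projVanishingIdeal_anti (Set.image_subset_range p _)) s') key.symm).symm

/-- **All but three COLLINEAR points**: there is exactly one more dimension of forms of degree `s − 1`
vanishing on `Γ ∖ {p_i, p_j, p_l}` than vanishing on `Γ` when `p_i, p_j, p_l` are collinear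
(`k` infinite). [cite: EisenbudGreenHarris1996, §1.2, after Thm. CB5 (p. 304)] -/
theorem finrank_idealDegree_projVanishingIdeal_compl_triple (hr : 1 ≤ r)
    (f : Fin r → MvPolynomial (Fin (r + 1)) k) (d : Fin r → ℕ) (hf : ∀ m, (f m).IsHomogeneous (d m))
    (hd : ∀ m, 0 < d m) (hreg : IsWeaklyRegular (MvPolynomial (Fin (r + 1)) k) (List.ofFn f))
    (p : ι → Fin (r + 1) → k) (h0 : ∀ i, p i ≠ 0)
    (hp : Pairwise fun i j => p i ∉ (k ∙ p j : Submodule k (Fin (r + 1) → k)))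
    (hZ : ∀ i m, eval (p i) (f m) = 0) (hcard : Fintype.card ι = ∏ m, d m) {i j l : ι} (hij : i ≠ j)
    (hil : i ≠ l) (hjl : j ≠ l) {u v : Fin (r + 1) → k} (hi : p i ∈ Submodule.span k {u, v})
    (hj : p j ∈ Submodule.span k {u, v}) (hl : p l ∈ Submodule.span k {u, v})
    {s' : ℕ} (hs' : s' + r + 2 = ∑ m, d m) :
    finrank k (idealDegree (projVanishingIdeal (p '' ({i, j, l} : Set ι)ᶜ)) s') =
      finrank k (idealDegree (projVanishingIdeal (Set.range p)) s') + 1 := by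
  set T : Finset ι := ({i, j, l} : Finset ι)ᶜ with hT
  have hTset : (T : Set ι) = ({i, j, l} : Set ι)ᶜ := by
    rw [hT, Finset.coe_compl, Finset.coe_insert, Finset.coe_insert, Finset.coe_singleton]
  have hcard3 : ({i, j, l} : Finset ι).card = 3 := by
    rw [Finset.card_insert_of_notMem (by simp [hij, hil]), Finset.card_pair hjl]
  have huv : ∀ a, ![p i, p j, p l] a ∈ Submodule.span k {u, v} := fun a => by
    fin_cases a
    · exact hi
    · exact hj
    · exact hl
  have key := finrank_idealDegree_projVanishingIdeal_image_eq_add hr f d hf hd hreg p h0 hp hZ hcard T hs'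
  rw [show Tᶜ = {i, j, l} from by rw [hT, compl_compl], hcard3, hTset, compl_compl,
    image_triple_eq_range, hilbert_one_triple_of_collinear ![p i, p j, p l]
      (fun a => by fin_cases a <;> exact h0 _) (pairwise_triple p hp hij hil hjl) huv] at key
  rw [key]

/-- **"There exists a curve of degree `s − 1` containing all but three points `p, q, r ∈ Γ` but not
containing `Γ` if and only if `p`, `q`, and `r` are collinear"** — for a reduced complete intersection of
`r` hypersurfaces of degrees `d_m` in `ℙ^r`, `s − 1 = Σ d_m − r − 2` (`k` infinite).
[cite: EisenbudGreenHarris1996, §1.2, after Thm. CB5 (p. 304)] -/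
theorem exists_form_compl_triple_iff_collinear (hr : 1 ≤ r)
    (f : Fin r → MvPolynomial (Fin (r + 1)) k) (d : Fin r → ℕ) (hf : ∀ m, (f m).IsHomogeneous (d m))
    (hd : ∀ m, 0 < d m) (hreg : IsWeaklyRegular (MvPolynomial (Fin (r + 1)) k) (List.ofFn f))
    (p : ι → Fin (r + 1) → k) (h0 : ∀ i, p i ≠ 0)
    (hp : Pairwise fun i j => p i ∉ (k ∙ p j : Submodule k (Fin (r + 1) → k)))
    (hZ : ∀ i m, eval (p i) (f m) = 0) (hcard : Fintype.card ι = ∏ m, d m) {i j l : ι} (hij : i ≠ j)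
    (hil : i ≠ l) (hjl : j ≠ l) {s' : ℕ} (hs' : s' + r + 2 = ∑ m, d m) :
    (∃ G : MvPolynomial (Fin (r + 1)) k, G.IsHomogeneous s' ∧
        (∀ m, m ≠ i → m ≠ j → m ≠ l → eval (p m) G = 0) ∧ ¬ ∀ m, eval (p m) G = 0) ↔
      ∃ u v : Fin (r + 1) → k, p i ∈ Submodule.span k {u, v} ∧ p j ∈ Submodule.span k {u, v} ∧
        p l ∈ Submodule.span k {u, v} := by
  -- membership in `I(Γ ∖ {p_i, p_j, p_l})_{s'}` and in `I(Γ)_{s'}`, spelled out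
  have hmem : ∀ {G : MvPolynomial (Fin (r + 1)) k}, G.IsHomogeneous s' →
      (G ∈ idealDegree (projVanishingIdeal (p '' ({i, j, l} : Set ι)ᶜ)) s' ↔
        ∀ m, m ≠ i → m ≠ j → m ≠ l → eval (p m) G = 0) := fun {G} hG => by
    rw [mem_idealDegree, mem_projVanishingIdeal_iff_of_isHomogeneous hG]
    constructor
    · rintro ⟨h, -⟩ m h1 h2 h3
      exact h (p m) ⟨m, by simp [h1, h2, h3], rfl⟩
    · intro h
      refine ⟨?_, hG⟩
      rintro _ ⟨m, hm, rfl⟩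
      simp only [Set.mem_compl_iff, Set.mem_insert_iff, Set.mem_singleton_iff, not_or] at hm
      exact h m hm.1 hm.2.1 hm.2.2
  have hmem' : ∀ {G : MvPolynomial (Fin (r + 1)) k}, G.IsHomogeneous s' →
      (G ∈ idealDegree (projVanishingIdeal (Set.range p)) s' ↔ ∀ m, eval (p m) G = 0) := fun {G} hG => by
    rw [mem_idealDegree, mem_projVanishingIdeal_iff_of_isHomogeneous hG, Set.forall_mem_range]
    exact ⟨fun h => h.1, fun h => ⟨h, hG⟩⟩
  constructor
  · rintro ⟨G, hG, hG1, hG2⟩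
    by_contra hcol
    have heq := idealDegree_projVanishingIdeal_compl_triple_eq hr f d hf hd hreg p h0 hp hZ hcard hij hil
      hjl hcol hs'
    exact hG2 ((hmem' hG).mp (heq ▸ (hmem hG).mpr hG1))
  · rintro ⟨u, v, hi, hj, hl⟩
    have hlt := finrank_idealDegree_projVanishingIdeal_compl_triple hr f d hf hd hreg p h0 hp hZ hcard hij
      hil hjl hi hj hl hs'
    -- `I(Γ)_{s'} < I(Γ')_{s'}` strictly: pick a form in the difference
    have hne : ¬ idealDegree (projVanishingIdeal (p '' ({i, j, l} : Set ι)ᶜ)) s' ≤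
        idealDegree (projVanishingIdeal (Set.range p)) s' := by
      intro hle
      haveI := finite_homogeneousSubmodule (K := k) (σ := Fin (r + 1)) s'
      haveI : FiniteDimensional k (idealDegree (projVanishingIdeal (Set.range p)) s') :=
        Submodule.finiteDimensional_of_le (idealDegree_le_homogeneousSubmodule _ _)
      have h := Submodule.finrank_mono hle
      omega
    obtain ⟨G, hG1, hG2⟩ := Set.not_subset.mp hne
    have hG : G.IsHomogeneous s' := (mem_idealDegree.mp hG1).2
    exact ⟨G, hG, (hmem hG).mp hG1, fun h => hG2 ((hmem' hG).mpr h)⟩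

end CompleteIntersection

/-! ### § 3 Plane curves, as printed: `s − 1 = d + e − 4` -/

/-- **EGH after Theorem CB5: "any curve of degree `s − 1 = d + e − 4` containing all but two points of
`Γ` contains `Γ`"** — `Γ` the `d · e` distinct points common to two plane curves `F = 0`, `G = 0` of
degrees `d, e` without common component (`k` infinite).
[cite: EisenbudGreenHarris1996, §1.2, after Thm. CB5 (p. 304)] -/
theorem idealDegree_projVanishingIdeal_compl_pair_eq_of_planeCurves [Infinite k] [DecidableEq ι]
    (F G : MvPolynomial (Fin 3) k) {dF dG : ℕ} (hF : F.IsHomogeneous dF) (hG : G.IsHomogeneous dG)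
    (hdF : 0 < dF) (hdG : 0 < dG) (hreg : IsWeaklyRegular (MvPolynomial (Fin 3) k) [F, G])
    (p : ι → Fin 3 → k) (h0 : ∀ i, p i ≠ 0)
    (hp : Pairwise fun i j => p i ∉ (k ∙ p j : Submodule k (Fin 3 → k)))
    (hZF : ∀ i, eval (p i) F = 0) (hZG : ∀ i, eval (p i) G = 0) (hcard : Fintype.card ι = dF * dG)
    {i j : ι} (hij : i ≠ j) {s' : ℕ} (hs' : s' + 4 = dF + dG) :
    idealDegree (projVanishingIdeal (p '' ({i, j} : Set ι)ᶜ)) s' =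
      idealDegree (projVanishingIdeal (Set.range p)) s' := by
  refine idealDegree_projVanishingIdeal_compl_pair_eq (r := 2) (by norm_num) ![F, G] ![dF, dG]
    (fun m => ?_) (fun m => ?_) (by simpa using hreg) p h0 hp (fun i m => ?_)
    (by rw [hcard, Fin.prod_univ_two]; rfl) hij (by rw [Fin.sum_univ_two]; exact hs')
  · fin_cases m
    · exact hF
    · exact hG
  · fin_cases m
    · exact hdF
    · exact hdG
  · fin_cases m
    · exact hZF i
    · exact hZG i

/-- **EGH after Theorem CB5: "there exists a curve of degree `s − 1 = d + e − 4` containing all but three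
points `p, q, r ∈ Γ` but not containing `Γ` if and only if `p`, `q`, and `r` are collinear"** (`Γ` the
`d · e` distinct points common to two plane curves of degrees `d, e` without common component; `k`
infinite). [cite: EisenbudGreenHarris1996, §1.2, after Thm. CB5 (p. 304)] -/
theorem exists_form_compl_triple_iff_collinear_of_planeCurves [Infinite k] [DecidableEq ι]
    (F G : MvPolynomial (Fin 3) k) {dF dG : ℕ} (hF : F.IsHomogeneous dF) (hG : G.IsHomogeneous dG)
    (hdF : 0 < dF) (hdG : 0 < dG) (hreg : IsWeaklyRegular (MvPolynomial (Fin 3) k) [F, G])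
    (p : ι → Fin 3 → k) (h0 : ∀ i, p i ≠ 0)
    (hp : Pairwise fun i j => p i ∉ (k ∙ p j : Submodule k (Fin 3 → k)))
    (hZF : ∀ i, eval (p i) F = 0) (hZG : ∀ i, eval (p i) G = 0) (hcard : Fintype.card ι = dF * dG)
    {i j l : ι} (hij : i ≠ j) (hil : i ≠ l) (hjl : j ≠ l) {s' : ℕ} (hs' : s' + 4 = dF + dG) :
    (∃ H : MvPolynomial (Fin 3) k, H.IsHomogeneous s' ∧
        (∀ m, m ≠ i → m ≠ j → m ≠ l → eval (p m) H = 0) ∧ ¬ ∀ m, eval (p m) H = 0) ↔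
      ∃ u v : Fin 3 → k, p i ∈ Submodule.span k {u, v} ∧ p j ∈ Submodule.span k {u, v} ∧
        p l ∈ Submodule.span k {u, v} := by
  refine exists_form_compl_triple_iff_collinear (r := 2) (by norm_num) ![F, G] ![dF, dG]
    (fun m => ?_) (fun m => ?_) (by simpa using hreg) p h0 hp (fun i m => ?_)
    (by rw [hcard, Fin.prod_univ_two]; rfl) hij hil hjl (by rw [Fin.sum_univ_two]; exact hs')
  · fin_cases m
    · exact hF
    · exact hG
  · fin_cases m
    · exact hdF
    · exact hdG
  · fin_cases m
    · exact hZF i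
    · exact hZG i

end Literature.AlgebraicGeometry.ProjectiveSpace

end
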